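import Literature.NumberTheory.NumberFields.ClassGroupMinusPartOddCharacters
import Literature.NumberTheory.IwasawaTheory.ClassicalMuVanishesReflectionLayer
import Literature.NumberTheory.IwasawaTheory.ClassicalMuVanishesIffBoundedRank
import Literature.NumberTheory.IwasawaTheory.ClassicalMuVanishesSubextension
import HarnessLib

set_option autoImplicit false

/-!
# Odd-character reflection up the cyclotomic `ℤ_p`-tower: `rank_p Cl((L·F_∞)_n) ≤ 1 + 2·∑_{χ odd} rank_p Cl((L^{ker χ}·F_∞)_n)`
# at every layer, and `μ(L) = 0` from `μ = 0` of the ODD sub-towers alone (theorem-only; no named fact, no `sorry`)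

Topic `NumberTheory/IwasawaTheory` (namespace = path).  THEOREM-ONLY file written by the prover seat `bsd-potss-rkm` (generation 37,
cell `bsd-potss`; `--supports` stmt-BirchSwinnertonDyer-19196, crux M `ReducibleKatoMember` of the routes K9 / K8-t′; closes nothing).
It is the tower form of `NumberFields/ClassGroupMinusPartOddCharacters.lean` and generalises generation 36's
`ClassicalMuVanishesReflection{Layer,Descent}.lean` (the biquadratic configuration `⟨z, b⟩`) to any finite commutative `G` of
exponent dividing `p − 1` acting on `L` — e.g. the full Galois group of an abelian CM field `L ∋ ζ_p` with `exp Gal(L/F) ∣ p − 1`,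
such as the Borel field `ℚ(χ₁, χ₂)` of an elliptic curve with reducible `E[p]` (`[ℚ(χ₁,χ₂) : ℚ] ∣ (p−1)²`).

## The mathematics (all inputs are tree theorems)

`F` totally real, `p` odd, `κ` a `ℤ_p`-extension of `F` with layers `F_n` (totally real: odd degree), `L/F` finite Galois with
`L ∩ F_∞ = F`, `L` totally complex with `ζ_p ∈ L`; `G` finite commutative with `exp G ∣ p − 1`, `t : G → Gal(L/F)`, `z ∈ G` an
involution with `t z ≠ 1` and `L^{⟨t z⟩}` totally real.  The layer `L·F_n ⊆ F̄` is Galois over `F`, totally complex, contains `ζ_p`,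
and the section `s : Gal(L/F) ↪ Gal(L·F_n/F)` of `RestrictedTowerLayerSection.lean` has `(L·F_n)^{s(H)} = L^H·F_n ≅ (L^H·F_∞)_n`
for every `H ≤ Gal(L/F)`; `(L·F_n)^{⟨s(t z)⟩} = L^{⟨t z⟩}·F_n` is totally real.  The one-field inequality
`natCard_torsion_classGroup_le_of_oddCharacters` for `K = L·F_n` and `s ∘ t : G → Gal(L·F_n/F)` reads, layer by layer,
  **`rank_p Cl((L·F_∞)_n) ≤ 1 + 2·∑_{χ : G → 𝔽_pˣ, χ(z) ≠ 1} rank_p Cl((L^{t(ker χ)}·F_∞)_n)`** (`classGroupPRank_restrict_le_oddCharacters`),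
and with «`μ = 0` ⟺ bounded `p`-ranks» (tree `classicalMuVanishes_iff_exists_forall_classGroupPRank_le`, Washington Prop. 13.23 at
finite level):
  **`μ(L^{t(ker χ)}·F_∞ / L^{t(ker χ)}) = 0` for every ODD `χ` ⟹ `μ(L·F_∞/L) = 0`** (`classicalMuVanishes_restrict_of_oddCharacters`),
growth form, fact-free.  This is the algebraic half of Ferrero–Washington's theorem in full generality (`μ⁺ ≤ μ⁻` by reflection and
the isotypic descent of `μ⁻` to the odd cyclic sub-towers); the analytic half — `μ = 0` for the cyclotomic `ℤ_p`-tower of each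
IMAGINARY CYCLIC field `ℚ(χ)`, `χ` odd — remains the input.  Consumer forms (Galois group itself, intermediate-field phrasing,
`F = ℚ`) are in `ClassicalMuVanishesOddCharacterDescent.lean`.

## Main results

* `classGroupPRank_restrict_le_oddCharacters` — the layerwise inequality.
* `classicalMuVanishes_restrict_of_oddCharacters` — the `μ`-descent in growth form.
* `classicalMuVanishes_of_isCyclotomic_of_oddCharacters` — «∀ cyclotomic» form (`p ∤ [L : F]`).

## What is NOT here (honest scope)

No `p`-adic `L`-function, no `μ⁻ = 0`; nothing about elliptic curves.  BSD is advanced for no curve by this file.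

## References

* L. C. Washington, *Introduction to Cyclotomic Fields*, 2nd ed., GTM 83 (1997): §6.3, §7.5 (Ferrero–Washington: reduction to odd
  characters), §10.2 (Thm. 10.10–10.11), §13.1, §13.3 Prop. 13.23. [Washington1997]
* S. Lang, *Cyclotomic Fields I and II*, GTM 121 (1990), Ch. 13 §2, Thm. 2.1 (i). [Lang1990]
* B. Ferrero, L. C. Washington, Ann. of Math. 109 (1979) 377–395 — the theorem whose algebraic half this is. [FerreroWashington1979]
* Tree: `NumberFields/ClassGroupMinusPartOddCharacters.lean` (g37), `IwasawaTheory/ClassicalMuVanishesReflectionLayer.lean` (g36; the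
  private tower lemmas of §1 are adapted from it), `IwasawaTheory/RestrictedTowerLayerSection.lean`,
  `IwasawaTheory/ClassicalMuVanishesIffBoundedRank.lean`, `IwasawaTheory/ClassicalMuVanishesSubextension.lean`.
-/

noncomputable section

open scoped NumberField

open Field IntermediateField NumberField NumberField.InfinitePlace
  Literature.NumberTheory.GaloisRepresentations Literature.NumberTheory.EllipticCurves
  Literature.NumberTheory.EllipticCurves.ZpExtension Literature.NumberTheory.NumberFields

namespace Literature.NumberTheory.IwasawaTheory

/-! ### §1 Tower bookkeeping (adapted from `ClassicalMuVanishesReflectionLayer.lean`, whose copies are private) -/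

section Tower

variable {F : Type} [Field F] [NumberField F] {p : ℕ} [hp : Fact p.Prime]

/-- `#{m : m^q = 1}` is invariant under isomorphism. [folklore] -/
private theorem natCard_torsion_congr' {M M' : Type*} [CommGroup M] [CommGroup M'] (e : M ≃* M') (q : ℕ) :
    Nat.card {m : M // m ^ q = 1} = Nat.card {m : M' // m ^ q = 1} := by
  refine Nat.card_congr (e.toEquiv.subtypeEquiv fun m => ?_)
  change m ^ q = 1 ↔ e m ^ q = 1
  rw [← map_pow, MulEquiv.map_eq_one_iff]

/-- The `p`-torsion count of the class group of `(L·F_n)^{s(H)} = L^H·F_n` is `p ^ rank_p Cl((L^H·F_∞)_n)`.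
[cite: Washington1997, §13.1] -/
private theorem natCard_torsion_fixedField_map_eq' (κ : ZpExtension F p) (L : Type) [Field L] [NumberField L]
    [Algebra F L] [IsGalois F L] (n : ℕ)
    (s : (L ≃ₐ[F] L) →*
      (↥((absEmbedding F L).fieldRange ⊔ κ.layer n) ≃ₐ[F] ↥((absEmbedding F L).fieldRange ⊔ κ.layer n)))
    (hfix : ∀ H : Subgroup (L ≃ₐ[F] L), IntermediateField.lift (fixedField (H.map s)) =
      IntermediateField.map (absEmbedding F L) (fixedField H) ⊔ κ.layer n)
    (H : Subgroup (L ≃ₐ[F] L))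
    (hH : Function.Surjective (κ.toContinuousMonoidHom.comp (absGaloisRestrict F ↥(fixedField H)))) :
    Nat.card {d : ClassGroup (𝓞 ↥(fixedField (H.map s))) // d ^ p = 1} =
      p ^ classGroupPRank (κ.restrict ↥(fixedField H) hH) n := by
  haveI : FiniteDimensional F L := Module.Finite.of_restrictScalars_finite ℚ F L
  haveI := isGalois_fieldRange_sup_layer κ L (absEmbedding F L) n
  haveI := finiteDimensional_fieldRange_sup_layer κ L (absEmbedding F L) n
  haveI := numberField_fieldRange_sup_layer κ L (absEmbedding F L) n
  have e₁ : ↥(fixedField (H.map s)) ≃ₐ[F] ↥(IntermediateField.map (absEmbedding F L) (fixedField H) ⊔ κ.layer n) :=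
    (IntermediateField.liftAlgEquiv (fixedField (H.map s))).trans (IntermediateField.equivOfEq (hfix H))
  obtain ⟨e₂⟩ := nonempty_algEquiv_layer_restrict_fieldRange_sup_layer κ ↥(fixedField H) hH
    ((absEmbedding F L).comp (fixedField H).val) n
  rw [IntermediateField.fieldRange_comp_val] at e₂
  rw [← natCard_torsion_classGroup_layer_eq (κ.restrict ↥(fixedField H) hH) n]
  exact (natCard_torsion_congr' (ClassGroup.mulEquiv
    (RingOfIntegers.mapRingEquiv (e₂.trans e₁.symm).toRingEquiv)) p).symm

/-- The `p`-torsion count of the class group of the whole layer `L·F_n` is `p ^ rank_p Cl((L·F_∞)_n)`.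
[cite: Washington1997, §13.1] -/
private theorem natCard_torsion_top_eq (κ : ZpExtension F p) (L : Type) [Field L] [NumberField L]
    [Algebra F L] (hL : Function.Surjective (κ.toContinuousMonoidHom.comp (absGaloisRestrict F L))) (n : ℕ) :
    Nat.card {d : ClassGroup (𝓞 ↥((absEmbedding F L).fieldRange ⊔ κ.layer n)) // d ^ p = 1} =
      p ^ classGroupPRank (κ.restrict L hL) n := by
  obtain ⟨e⟩ := nonempty_algEquiv_layer_restrict_fieldRange_sup_layer κ L hL (absEmbedding F L) n
  rw [← natCard_torsion_classGroup_layer_eq (κ.restrict L hL) n]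
  exact (natCard_torsion_congr' (ClassGroup.mulEquiv (RingOfIntegers.mapRingEquiv e.toRingEquiv)) p).symm

/-- The compositum `e(L)·F_n ⊆ F̄` receives `L`, so it is totally complex when `L` is. [cite: Washington1997, §13.1] -/
private theorem isTotallyComplex_fieldRange_sup_layer' (κ : ZpExtension F p) (L : Type) [Field L] [NumberField L]
    [Algebra F L] [IsTotallyComplex L] (n : ℕ) :
    IsTotallyComplex ↥((absEmbedding F L).fieldRange ⊔ κ.layer n) := by
  let eL : L →+* ↥((absEmbedding F L).fieldRange ⊔ κ.layer n) :=
    (absEmbedding F L : L →+* AlgebraicClosure F).codRestrict ((absEmbedding F L).fieldRange ⊔ κ.layer n) fun x =>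
      (le_sup_left : (absEmbedding F L).fieldRange ≤ (absEmbedding F L).fieldRange ⊔ κ.layer n)
        ((absEmbedding F L).mem_fieldRange.mpr ⟨x, rfl⟩)
  letI : Algebra L ↥((absEmbedding F L).fieldRange ⊔ κ.layer n) := eL.toAlgebra
  exact isTotallyComplex_of_algebra L _

/-- A primitive `q`-th root of unity of `L` gives one of `e(L)·F_n`. [cite: Washington1997, §13.1] -/
private theorem exists_isPrimitiveRoot_fieldRange_sup_layer' (κ : ZpExtension F p) (L : Type) [Field L] [NumberField L]
    [Algebra F L] {q : ℕ} {ζ : L} (hζ : IsPrimitiveRoot ζ q) (n : ℕ) :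
    ∃ ζ' : ↥((absEmbedding F L).fieldRange ⊔ κ.layer n), IsPrimitiveRoot ζ' q := by
  let eL : L →+* ↥((absEmbedding F L).fieldRange ⊔ κ.layer n) :=
    (absEmbedding F L : L →+* AlgebraicClosure F).codRestrict ((absEmbedding F L).fieldRange ⊔ κ.layer n) fun x =>
      (le_sup_left : (absEmbedding F L).fieldRange ≤ (absEmbedding F L).fieldRange ⊔ κ.layer n)
        ((absEmbedding F L).mem_fieldRange.mpr ⟨x, rfl⟩)
  exact ⟨eL ζ, hζ.map_of_injective eL.injective⟩

/-- A finite Galois extension of odd degree of a totally real field is totally real. [cite: Washington1997, §13.1] -/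
private theorem isTotallyReal_of_isGalois_of_odd_finrank' (k K : Type*) [Field k] [NumberField k] [IsTotallyReal k]
    [Field K] [NumberField K] [Algebra k K] [IsGalois k K] (hodd : Odd (Module.finrank k K)) :
    IsTotallyReal K where
  isReal w := by
    have hun : w.IsUnramified k := by
      by_contra h
      exact (Nat.not_even_iff_odd.mpr hodd) (even_finrank_of_not_isUnramified h)
    rcases isUnramified_iff.mp hun with h | h
    · exact h
    · exact absurd (IsTotallyReal.isReal (w.comap (algebraMap k K))) (not_isReal_iff_isComplex.mpr h)

/-- The layers of a `ℤ_p`-extension (`p` odd) of a totally real field are totally real. [cite: Washington1997, §13.1] -/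
private theorem isTotallyReal_layer' [IsTotallyReal F] (hp2 : p ≠ 2) (κ : ZpExtension F p) (n : ℕ) :
    IsTotallyReal ↥(κ.layer n) := by
  haveI : FiniteDimensional F (κ.layer n) := κ.finiteDimensional_layer_holds n
  haveI : NumberField (κ.layer n) := NumberField.of_module_finite F _
  haveI : IsGalois F (κ.layer n) := κ.isGalois_layer_holds n
  refine isTotallyReal_of_isGalois_of_odd_finrank' F _ ?_
  rw [κ.finrank_layer_holds n]
  exact Odd.pow (hp.out.odd_of_ne_two hp2)

/-- The compositum of two totally real intermediate fields is totally real. [folklore] -/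
private theorem isTotallyReal_sup_intermediateField' {k Ω : Type*} [Field k] [Field Ω] [CharZero Ω] [Algebra k Ω]
    [Algebra.IsAlgebraic ℚ Ω] (A B : IntermediateField k Ω) [hA : IsTotallyReal ↥A] [hB : IsTotallyReal ↥B] :
    IsTotallyReal ↥(A ⊔ B) := by
  haveI : IsTotallyReal ↥A.toSubfield := IsTotallyReal.ofRingEquiv (RingEquiv.refl ↥A)
  haveI : IsTotallyReal ↥B.toSubfield := IsTotallyReal.ofRingEquiv (RingEquiv.refl ↥B)
  have h : IsTotallyReal ↥(A.toSubfield ⊔ B.toSubfield) := isTotallyReal_sup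
  exact IsTotallyReal.ofRingEquiv (RingEquiv.subfieldCongr (IntermediateField.sup_toSubfield A B).symm)

/-- `(L·F_n)^{⟨s z⟩} = e(L^{⟨z⟩})·F_n` is totally real when `L^{⟨z⟩}` and `F` are. [cite: Washington1997, §13.1] -/
private theorem isTotallyReal_fixedField_section' [IsTotallyReal F] (hp2 : p ≠ 2) (κ : ZpExtension F p) (L : Type)
    [Field L] [NumberField L] [Algebra F L] [IsGalois F L] (n : ℕ)
    (s : (L ≃ₐ[F] L) →*
      (↥((absEmbedding F L).fieldRange ⊔ κ.layer n) ≃ₐ[F] ↥((absEmbedding F L).fieldRange ⊔ κ.layer n)))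
    (hfix : ∀ H : Subgroup (L ≃ₐ[F] L), IntermediateField.lift (fixedField (H.map s)) =
      IntermediateField.map (absEmbedding F L) (fixedField H) ⊔ κ.layer n)
    (z : L ≃ₐ[F] L) (hreal : IsTotallyReal ↥(fixedField (Subgroup.zpowers z))) :
    IsTotallyReal ↥(fixedField (Subgroup.zpowers (s z))) := by
  haveI : FiniteDimensional F L := Module.Finite.of_restrictScalars_finite ℚ F L
  haveI := finiteDimensional_fieldRange_sup_layer κ L (absEmbedding F L) n
  haveI : Algebra.IsAlgebraic ℚ (AlgebraicClosure F) := Algebra.IsAlgebraic.trans ℚ F (AlgebraicClosure F)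
  haveI : IsTotallyReal ↥(fixedField (Subgroup.zpowers z)) := hreal
  haveI h1 : IsTotallyReal ↥(IntermediateField.map (absEmbedding F L) (fixedField (Subgroup.zpowers z))) :=
    IsTotallyReal.ofRingEquiv ((fixedField (Subgroup.zpowers z)).equivMap (absEmbedding F L)).toRingEquiv
  haveI h2 : IsTotallyReal ↥(κ.layer n) := isTotallyReal_layer' hp2 κ n
  haveI h3 : IsTotallyReal ↥(IntermediateField.map (absEmbedding F L) (fixedField (Subgroup.zpowers z)) ⊔ κ.layer n) :=
    isTotallyReal_sup_intermediateField' _ _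
  have hsub : Subgroup.zpowers (s z) = (Subgroup.zpowers z).map s := (MonoidHom.map_zpowers s z).symm
  have e₁a : ↥(fixedField (Subgroup.zpowers (s z))) ≃ₐ[F] ↥(fixedField ((Subgroup.zpowers z).map s)) :=
    IntermediateField.equivOfEq (congrArg fixedField hsub)
  have e₁b : ↥(fixedField ((Subgroup.zpowers z).map s)) ≃ₐ[F]
      ↥(IntermediateField.lift (fixedField ((Subgroup.zpowers z).map s))) :=
    IntermediateField.liftAlgEquiv _
  have e₁c : ↥(IntermediateField.lift (fixedField ((Subgroup.zpowers z).map s))) ≃ₐ[F]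
      ↥(IntermediateField.map (absEmbedding F L) (fixedField (Subgroup.zpowers z)) ⊔ κ.layer n) :=
    IntermediateField.equivOfEq (hfix (Subgroup.zpowers z))
  exact IsTotallyReal.ofRingEquiv ((e₁a.trans e₁b).trans e₁c).symm.toRingEquiv

/-! ### §2 The layerwise inequality -/

/-- **ODD-CHARACTER REFLECTION UP THE CYCLOTOMIC TOWER (layerwise `p`-rank inequality).**  `F` totally real, `p` an odd prime,
`κ` a `ℤ_p`-extension of `F`, `L/F` finite Galois with `κ ∘ res` onto (`L ∩ F_∞ = F`), `L` totally complex containing a primitive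
`p`-th root of unity; `G` a finite commutative group with `exp G ∣ p − 1` acting through `t : G → Gal(L/F)`, `z ∈ G` an involution
with `t z ≠ 1` and `L^{⟨t z⟩}` totally real.  Then FOR EVERY `n`, writing `r(E) := rank_p Cl((E·F_∞)_n)`:
  **`r(L) ≤ 1 + 2·∑_{χ : G → 𝔽_pˣ, χ(z) ≠ 1} r(L^{t(ker χ)})`.**
(`natCard_torsion_classGroup_le_of_oddCharacters` for the CM layer `L·F_n` — totally complex ∋ `ζ_p`, `(L·F_n)^{⟨s t z⟩} = L^{⟨t z⟩}F_n`
totally real — and `s ∘ t`, `s` the section of `exists_section_fixedField_map_eq`, whose fixed fields are the layers of the sub-towers.)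
[cite: Washington1997, §10.2 Thm. 10.11, §6.3, §13.1] [cite: Lang1990, Ch. 13 §2, Thm. 2.1 (i)] -/
theorem classGroupPRank_restrict_le_oddCharacters [IsTotallyReal F] (hp2 : p ≠ 2) (κ : ZpExtension F p) (L : Type)
    [Field L] [NumberField L] [Algebra F L] [IsGalois F L] [IsTotallyComplex L]
    (hL : Function.Surjective (κ.toContinuousMonoidHom.comp (absGaloisRestrict F L)))
    {ζ : L} (hζ : IsPrimitiveRoot ζ p) {G : Type} [CommGroup G] [Fintype G] [Fintype (G →* (ZMod p)ˣ)]
    (hG : Monoid.exponent G ∣ p - 1) (t : G →* (L ≃ₐ[F] L)) {z : G} (hz : z * z = 1) (hz1 : t z ≠ 1)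
    (hreal : IsTotallyReal ↥(fixedField (Subgroup.zpowers (t z))))
    (hH : ∀ χ : G →* (ZMod p)ˣ, Function.Surjective
      (κ.toContinuousMonoidHom.comp (absGaloisRestrict F ↥(fixedField ((χ.ker).map t)))))
    (n : ℕ) :
    classGroupPRank (κ.restrict L hL) n ≤
      1 + 2 * ∑ χ : {χ : G →* (ZMod p)ˣ // χ z ≠ 1},
        classGroupPRank (κ.restrict ↥(fixedField (((χ : G →* (ZMod p)ˣ).ker).map t)) (hH χ)) n := by
  classical
  haveI : FiniteDimensional F L := Module.Finite.of_restrictScalars_finite ℚ F L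
  haveI := isGalois_fieldRange_sup_layer κ L (absEmbedding F L) n
  haveI := finiteDimensional_fieldRange_sup_layer κ L (absEmbedding F L) n
  haveI := numberField_fieldRange_sup_layer κ L (absEmbedding F L) n
  haveI := isTotallyComplex_fieldRange_sup_layer' κ L n
  obtain ⟨ζ', hζ'⟩ := exists_isPrimitiveRoot_fieldRange_sup_layer' κ L hζ n
  obtain ⟨s, hs_inj, hfix, -⟩ := exists_section_fixedField_map_eq κ L hL n
  -- the one-field inequality at the CM layer `L·F_n`, for `s ∘ t`
  have hz1' : (s.comp t) z ≠ 1 := fun h => hz1 (hs_inj (by rw [map_one]; exact h))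
  have hreal' : IsTotallyReal ↥(fixedField (Subgroup.zpowers ((s.comp t) z))) :=
    isTotallyReal_fixedField_section' hp2 κ L n s hfix (t z) hreal
  have hmain := natCard_torsion_classGroup_le_of_oddCharacters F ↥((absEmbedding F L).fieldRange ⊔ κ.layer n)
    hp2 hζ' hG (s.comp t) hz hz1' hreal'
  -- identify the counts
  rw [natCard_torsion_top_eq κ L hL n] at hmain
  have hfac : ∀ χ : {χ : G →* (ZMod p)ˣ // χ z ≠ 1},
      Nat.card {d : ClassGroup (𝓞 ↥(fixedField ((((χ : G →* (ZMod p)ˣ).ker).map (s.comp t))))) // d ^ p = 1} =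
        p ^ classGroupPRank (κ.restrict ↥(fixedField (((χ : G →* (ZMod p)ˣ).ker).map t)) (hH χ)) n := by
    intro χ
    rw [← natCard_torsion_fixedField_map_eq' κ L n s hfix _ (hH χ), Subgroup.map_map]
  simp only [hfac, Finset.prod_pow_eq_pow_sum] at hmain
  have hp1 : 1 < p := hp.out.one_lt
  have key : p ^ classGroupPRank (κ.restrict L hL) n ≤
      p ^ (1 + 2 * ∑ χ : {χ : G →* (ZMod p)ˣ // χ z ≠ 1},
        classGroupPRank (κ.restrict ↥(fixedField (((χ : G →* (ZMod p)ˣ).ker).map t)) (hH χ)) n) := by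
    calc _ ≤ _ := hmain
      _ = _ := by rw [← pow_mul, pow_add, pow_one, mul_comm (∑ χ : {χ : G →* (ZMod p)ˣ // χ z ≠ 1}, _) 2]
  exact (Nat.pow_le_pow_iff_right hp1).mp key

/-! ### §3 The `μ`-descent -/

/-- **`μ = 0` FOR `L` FROM `μ = 0` OF THE ODD SUB-TOWERS ALONE (growth form; fact-free).**  In the setting of
`classGroupPRank_restrict_le_oddCharacters`: if the restricted tower over `L^{t(ker χ)}` has `μ = 0` (`ClassicalMuVanishes`) for every
character `χ` of `G` with `χ(z) ≠ 1`, then so does `L·F_∞/L` — «`μ = 0` ⟺ bounded `p`-ranks» (tree, Washington Prop. 13.23 at finite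
level) and the layerwise inequality.  The EVEN characters (real sub-towers, including `L^{⟨t z⟩}` itself) are NOT inputs: this is the
algebraic half of Ferrero–Washington's theorem (reflection + isotypic descent) in the tree's numerical currency.
[cite: Washington1997, §7.5 (reduction to odd characters), §10.2 Thm. 10.11, §13.3 Prop. 13.23] [cite: Lang1990, Ch. 13 §2, Thm. 2.1 (i)] -/
theorem classicalMuVanishes_restrict_of_oddCharacters [IsTotallyReal F] (hp2 : p ≠ 2) (κ : ZpExtension F p) (L : Type)
    [Field L] [NumberField L] [Algebra F L] [IsGalois F L] [IsTotallyComplex L]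
    (hL : Function.Surjective (κ.toContinuousMonoidHom.comp (absGaloisRestrict F L)))
    {ζ : L} (hζ : IsPrimitiveRoot ζ p) {G : Type} [CommGroup G] [Fintype G] [Fintype (G →* (ZMod p)ˣ)]
    (hG : Monoid.exponent G ∣ p - 1) (t : G →* (L ≃ₐ[F] L)) {z : G} (hz : z * z = 1) (hz1 : t z ≠ 1)
    (hreal : IsTotallyReal ↥(fixedField (Subgroup.zpowers (t z))))
    (hH : ∀ χ : G →* (ZMod p)ˣ, Function.Surjective
      (κ.toContinuousMonoidHom.comp (absGaloisRestrict F ↥(fixedField ((χ.ker).map t)))))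
    (hμ : ∀ χ : G →* (ZMod p)ˣ, χ z ≠ 1 → ClassicalMuVanishes (κ.restrict ↥(fixedField ((χ.ker).map t)) (hH χ))) :
    ClassicalMuVanishes (κ.restrict L hL) := by
  classical
  have hB : ∀ χ : {χ : G →* (ZMod p)ˣ // χ z ≠ 1}, ∃ B : ℕ, ∀ m,
      classGroupPRank (κ.restrict ↥(fixedField (((χ : G →* (ZMod p)ˣ).ker).map t)) (hH χ)) m ≤ B := fun χ =>
    exists_forall_classGroupPRank_le_of_classicalMuVanishes _ (hμ χ χ.2)
  choose B hB using hB
  refine classicalMuVanishes_of_forall_classGroupPRank_le _ (B := 1 + 2 * ∑ χ, B χ) fun m => ?_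
  refine (classGroupPRank_restrict_le_oddCharacters hp2 κ L hL hζ hG t hz hz1 hreal hH m).trans ?_
  exact Nat.add_le_add_left (Nat.mul_le_mul_left 2 (Finset.sum_le_sum fun χ _ => hB χ m)) 1

omit [NumberField F] hp in
/-- `p ∤ [E : F]` for an intermediate field `E` of `L/F` when `p ∤ [L : F]`. [folklore] -/
private theorem not_dvd_finrank_intermediateField''' {L : Type} [Field L] [Algebra F L] [FiniteDimensional F L]
    (hpL : ¬ p ∣ Module.finrank F L) (E : IntermediateField F L) : ¬ p ∣ Module.finrank F ↥E := fun h =>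
  hpL (h.trans (Dvd.intro _ (Module.finrank_mul_finrank F ↥E L)))

/-- **«∀ cyclotomic» form of the odd-character descent.**  `F` totally real, `p` odd, `L/F` finite Galois with `p ∤ [L : F]`, `L` totally
complex containing `ζ_p`, `G` finite commutative with `exp G ∣ p − 1`, `t : G → Gal(L/F)`, `z ∈ G` an involution with `t z ≠ 1` and
`L^{⟨t z⟩}` totally real.  If for every character `χ` of `G` with `χ(z) ≠ 1` every cyclotomic `ℤ_p`-extension of `L^{t(ker χ)}` has `μ = 0`,
then every cyclotomic `ℤ_p`-extension of `L` has `μ = 0`. [cite: Washington1997, §7.5, §10.2, §13.1, §13.3 Prop. 13.23]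
[cite: Lang1990, Ch. 13 §2, Thm. 2.1 (i)] -/
theorem classicalMuVanishes_of_isCyclotomic_of_oddCharacters [IsTotallyReal F] (hp2 : p ≠ 2) (L : Type) [Field L]
    [NumberField L] [Algebra F L] [IsGalois F L] [IsTotallyComplex L] (hpL : ¬ p ∣ Module.finrank F L)
    {ζ : L} (hζ : IsPrimitiveRoot ζ p) {G : Type} [CommGroup G] [Fintype G] [Fintype (G →* (ZMod p)ˣ)]
    (hG : Monoid.exponent G ∣ p - 1) (t : G →* (L ≃ₐ[F] L)) {z : G} (hz : z * z = 1) (hz1 : t z ≠ 1)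
    (hreal : IsTotallyReal ↥(fixedField (Subgroup.zpowers (t z))))
    (hμ : ∀ χ : G →* (ZMod p)ˣ, χ z ≠ 1 →
      ∀ κE : ZpExtension ↥(fixedField ((χ.ker).map t)) p, κE.IsCyclotomic → ClassicalMuVanishes κE)
    (κL : ZpExtension L p) (hκL : κL.IsCyclotomic) : ClassicalMuVanishes κL := by
  obtain ⟨κ, hκ⟩ := exists_cyclotomicZpExtension_holds F p
  haveI : FiniteDimensional F L := Module.Finite.of_restrictScalars_finite ℚ F L
  have hs : ∀ E : IntermediateField F L, Function.Surjective
      (κ.toContinuousMonoidHom.comp (absGaloisRestrict F ↥E)) := fun E =>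
    surjective_comp_absGaloisRestrict_of_not_dvd_finrank κ _ (not_dvd_finrank_intermediateField''' hpL E)
  have hL := surjective_comp_absGaloisRestrict_of_not_dvd_finrank κ L hpL
  have h1 : ClassicalMuVanishes (κ.restrict L hL) :=
    classicalMuVanishes_restrict_of_oddCharacters hp2 κ L hL hζ hG t hz hz1 hreal (fun χ => hs _)
      fun χ hχ => hμ χ hχ _ (isCyclotomic_restrict κ hκ _ (hs _))
  exact (classicalMuVanishes_iff_of_isCyclotomic _ _ (isCyclotomic_restrict κ hκ L hL) hκL).mp h1

end Tower

end Literature.NumberTheory.IwasawaTheory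

end
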